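import Summits.RiemannHypothesis.RiemannHypothesis.Theorems.IntegerScrewCensusFloor80A

/-!
# Route `IntegerScrew` — census cell `M080-T305-dd` in the kernel: the DUAL checker on the cells `16 ≤ c < 48` (part B)

KERNEL FACTS (`decide +kernel`): `dualCheckW 79 305 40 EB 6000 a b … = true` on sub-ranges of `[16, 48)` for the dual
certificate literal `dpats80/deps80` of `IntegerScrewCensusFloor80A`.  RH-free; nothing here bears on the truth of RH.
-/

set_option linter.dupNamespace false
set_option autoImplicit false

namespace Summit.RiemannHypothesis.RiemannHypothesis.Theorems.IntegerScrew.Manifest.Fast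

open Literature.Analysis.ValidatedNumerics Literature.Analysis.ValidatedNumerics.Numerics

set_option maxRecDepth 200000 in
set_option maxHeartbeats 0 in
/-- KERNEL FACT: the cells `16 ≤ c < 32` pass. -/
theorem dualCheckW_80_16_32 : dualCheckW 79 305 40 EB 6000 16 32 RungCert.logs127 dpats80 deps80 = true := by
  decide +kernel

set_option maxRecDepth 200000 in
set_option maxHeartbeats 0 in
/-- KERNEL FACT: the cells `32 ≤ c < 48` pass. -/
theorem dualCheckW_80_32_48 : dualCheckW 79 305 40 EB 6000 32 48 RungCert.logs127 dpats80 deps80 = true := by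
  decide +kernel

end Summit.RiemannHypothesis.RiemannHypothesis.Theorems.IntegerScrew.Manifest.Fast
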